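import Literature.Geometry.Lorentzian.BilinPullbackEstimates
import Literature.Analysis.Calculus.PointPushDiffeomorphism
import HarnessLib

/-!
# Pulling back a smooth field of bilinear forms along the point pushes `y ↦ y + χ(y) • v`
(topic `Geometry/Lorentzian`; the analytic input of the point-pushing re-basing of pointed
`Cᵏ_loc` limits: `θ_v^* G → G` in `Cᵏ_loc` as `v → 0`; Petersen 2006, Ch. 10, §3.2)

For a field `G : E → (E →L E →L ℝ)` of bilinear forms which is `C^∞` on an open set `Ω`, a smooth
function `χ : E → ℝ`, and a compact `K ⊆ Ω`, the `Cᵏ` sup norm over `K` of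
`bilinPullback (pointPush χ v) G − G` tends to `0` as `v → 0`
(`tendsto_supCkENorm_bilinPullback_pointPush_sub`). Proof: the difference is a jointly `C^∞`
function `H(y, v)` of `(y, v)` on a neighbourhood of `K × {0}` vanishing identically for `v = 0`;
its iterated `y`-derivatives are restrictions of its full iterated derivatives
(`iteratedFDeriv_curry_left_eq_compContinuousLinearMap_inl`), which are uniformly continuous on
`K × closedBall 0 δ`.

## References
* [Petersen2006] P. Petersen, *Riemannian Geometry*, 2nd ed., GTM 171, Springer 2006, Ch. 10, §3.2.
-/

noncomputable section

open Set Filter Topology Function Metric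
open scoped ENNReal ContDiff Pointwise
open Literature.Analysis.Calculus

namespace Literature.Geometry.Lorentzian

/-! ### Iterated partial derivatives are restrictions of iterated total derivatives -/

section Partial

variable {E F G : Type*} [NormedAddCommGroup E] [NormedSpace ℝ E] [NormedAddCommGroup F]
  [NormedSpace ℝ F] [NormedAddCommGroup G] [NormedSpace ℝ G]

/-- **Iterated partial derivatives are restrictions of iterated total derivatives**: for `f`
of class `C^∞` on an open set `s ⊆ E × F` and `(x, w) ∈ s`, the `j`-th derivative of
`x' ↦ f (x', w)` at `x` is the `j`-th derivative of `f` at `(x, w)` composed with the inclusions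
`inl : E → E × F` in every slot. [folklore] -/
theorem iteratedFDeriv_curry_left_eq_compContinuousLinearMap_inl {f : E × F → G} {s : Set (E × F)}
    (hs : IsOpen s) (hf : ContDiffOn ℝ ∞ f s) {x : E} {w : F} (hx : (x, w) ∈ s) (j : ℕ) :
    iteratedFDeriv ℝ j (fun x' ↦ f (x', w)) x =
      (iteratedFDeriv ℝ j f (x, w)).compContinuousLinearMap fun _ ↦ ContinuousLinearMap.inl ℝ E F := by
  -- translate: `g z = f (z + (0, w))`, smooth on `s' = (· + (0, w))⁻¹ s`
  set a : E × F := (0, w) with ha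
  set s' : Set (E × F) := (fun z ↦ z + a) ⁻¹' s with hs'
  set g : E × F → G := fun z ↦ f (z + a) with hg
  have hs'o : IsOpen s' := hs.preimage (continuous_id.add continuous_const)
  have hvadd : a +ᵥ s' = s := by
    ext z
    rw [Set.mem_vadd_set]
    constructor
    · rintro ⟨y, hy, rfl⟩
      have : y + a ∈ s := hy
      rwa [vadd_eq_add, add_comm]
    · intro hz
      refine ⟨z - a, ?_, by rw [vadd_eq_add]; abel⟩
      show z - a + a ∈ s
      rwa [sub_add_cancel]
  have hgs : ContDiffOn ℝ ∞ g s' := hf.comp (contDiffOn_id.add contDiffOn_const) fun z hz ↦ hz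
  -- the curried function is `g ∘ inl`
  have hfun : (fun x' ↦ f (x', w)) = g ∘ ContinuousLinearMap.inl ℝ E F := by
    funext x'; simp [hg, ha]
  have hxs' : ContinuousLinearMap.inl ℝ E F x ∈ s' := by
    show (x, (0 : F)) + a ∈ s; simpa [ha] using hx
  have hpre : IsOpen (ContinuousLinearMap.inl ℝ E F ⁻¹' s') :=
    hs'o.preimage (ContinuousLinearMap.inl ℝ E F).continuous
  rw [hfun, ← iteratedFDerivWithin_of_isOpen j hpre hxs',
    (ContinuousLinearMap.inl ℝ E F).iteratedFDerivWithin_comp_right hgs hs'o.uniqueDiffOn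
      hpre.uniqueDiffOn hxs' (by exact_mod_cast le_top)]
  congr 1
  rw [hg, iteratedFDerivWithin_comp_add_right j a, hvadd, iteratedFDerivWithin_of_isOpen j hs]
  · congr 1; simp [ha]
  · show ContinuousLinearMap.inl ℝ E F x + a ∈ s; simpa [ha] using hx

/-- The restriction operator does not increase norms: `‖M ∘ (inl, …, inl)‖ ≤ ‖M‖`. [folklore] -/
theorem norm_compContinuousLinearMap_inl_le {j : ℕ}
    (M : ContinuousMultilinearMap ℝ (fun _ : Fin j ↦ E × F) G) :
    ‖M.compContinuousLinearMap fun _ ↦ ContinuousLinearMap.inl ℝ E F‖ ≤ ‖M‖ := by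
  refine (M.norm_compContinuousLinearMap_le _).trans ?_
  have h : ∏ _i : Fin j, ‖ContinuousLinearMap.inl ℝ E F‖ ≤ 1 :=
    Finset.prod_le_one (fun _ _ ↦ norm_nonneg _) fun _ _ ↦ ContinuousLinearMap.norm_inl_le_one ℝ E F
  exact mul_le_of_le_one_right (norm_nonneg _) h

end Partial

/-! ### The joint function and its smoothness -/

section PointPushPullback

variable {E : Type*} [NormedAddCommGroup E] [NormedSpace ℝ E]

/-- Pulling back along the identity does nothing. [folklore] -/
@[simp]
theorem bilinPullback_id (B : E → E →L[ℝ] E →L[ℝ] ℝ) : bilinPullback (id : E → E) B = B := by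
  funext y; ext v w; simp [bilinPullback_apply]

/-- The **joint difference function** `H(y, v) = (θ_v^* G)(y) − G(y)`, `θ_v = pointPush χ v`, written
with the explicit derivative `Dθ_v = id + Dχ ⊗ v`. [folklore] -/
def pushPullbackDiff (χ : E → ℝ) (G : E → E →L[ℝ] E →L[ℝ] ℝ) : E × E → E →L[ℝ] E →L[ℝ] ℝ :=
  fun p ↦ (ContinuousLinearMap.precomp ℝ
      (ContinuousLinearMap.id ℝ E + (fderiv ℝ χ p.1).smulRight p.2)).comp
    ((G (p.1 + χ p.1 • p.2)).comp (ContinuousLinearMap.id ℝ E + (fderiv ℝ χ p.1).smulRight p.2)) -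
    G p.1

/-- The joint function is the difference of pullbacks. [folklore] -/
theorem pushPullbackDiff_apply {χ : E → ℝ} (hχ : Differentiable ℝ χ) (G : E → E →L[ℝ] E →L[ℝ] ℝ)
    (y v : E) : pushPullbackDiff χ G (y, v) = bilinPullback (pointPush χ v) G y - G y := by
  simp only [pushPullbackDiff, bilinPullback, fderiv_pointPush (hχ y) v, pointPush_apply]

/-- For `v = 0` the joint function vanishes identically. [folklore] -/
theorem pushPullbackDiff_zero {χ : E → ℝ} (hχ : Differentiable ℝ χ)
    (G : E → E →L[ℝ] E →L[ℝ] ℝ) (y : E) : pushPullbackDiff χ G (y, 0) = 0 := by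
  rw [pushPullbackDiff_apply hχ, pointPush_zero, bilinPullback_id]
  exact sub_self (G y)

/-- **Joint smoothness** of `H` on `{(y, v) | y ∈ Ω, y + χ(y) • v ∈ Ω}` for `G` of class `C^∞` on
the open set `Ω` and `χ` of class `C^∞`. [folklore] -/
theorem contDiffOn_pushPullbackDiff {χ : E → ℝ} (hχ : ContDiff ℝ ∞ χ)
    {G : E → E →L[ℝ] E →L[ℝ] ℝ} {Ω : Set E} (hG : ContDiffOn ℝ ∞ G Ω) :
    ContDiffOn ℝ ∞ (pushPullbackDiff χ G) {p : E × E | p.1 ∈ Ω ∧ p.1 + χ p.1 • p.2 ∈ Ω} := by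
  set S : Set (E × E) := {p : E × E | p.1 ∈ Ω ∧ p.1 + χ p.1 • p.2 ∈ Ω} with hS
  have hfst : ContDiffOn ℝ ∞ (fun p : E × E ↦ p.1) S := contDiffOn_fst
  have hmove : ContDiffOn ℝ ∞ (fun p : E × E ↦ p.1 + χ p.1 • p.2) S :=
    (contDiff_fst.add ((hχ.comp contDiff_fst).smul contDiff_snd)).contDiffOn
  have hGm : ContDiffOn ℝ ∞ (fun p : E × E ↦ G (p.1 + χ p.1 • p.2)) S :=
    hG.comp hmove fun p hp ↦ hp.2
  have hG1 : ContDiffOn ℝ ∞ (fun p : E × E ↦ G p.1) S := hG.comp hfst fun p hp ↦ hp.1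
  have hD : ContDiffOn ℝ ∞
      (fun p : E × E ↦ ContinuousLinearMap.id ℝ E + (fderiv ℝ χ p.1).smulRight p.2) S := by
    refine contDiffOn_const.add ?_
    exact ((hχ.fderiv_right (m := ∞) (by exact_mod_cast le_rfl)).comp contDiff_fst).contDiffOn.smulRight
      contDiffOn_snd
  have hQ := hGm.clm_comp hD
  have hP : ContDiffOn ℝ ∞ (fun p : E × E ↦ (ContinuousLinearMap.precomp ℝ
      (ContinuousLinearMap.id ℝ E + (fderiv ℝ χ p.1).smulRight p.2) :
        (E →L[ℝ] ℝ) →L[ℝ] E →L[ℝ] ℝ)) S := by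
    have : (fun p : E × E ↦ (ContinuousLinearMap.precomp ℝ
        (ContinuousLinearMap.id ℝ E + (fderiv ℝ χ p.1).smulRight p.2) :
          (E →L[ℝ] ℝ) →L[ℝ] E →L[ℝ] ℝ)) =
        (ContinuousLinearMap.compL ℝ E E ℝ).flip ∘
          fun p : E × E ↦ ContinuousLinearMap.id ℝ E + (fderiv ℝ χ p.1).smulRight p.2 := by
      funext p; exact precomp_eq_flip_compL _
    rw [this]
    exact (ContinuousLinearMap.contDiff _).comp_contDiffOn hD
  exact (hP.clm_comp hQ).sub hG1

/-! ### The convergence -/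

/-- **Pulling back along the point pushes converges to the identity in `Cᵏ_loc`.** Let
`G : E → (E →L E →L ℝ)` be `C^∞` on an open set `Ω`, `χ : E → ℝ` of class `C^∞`, and `K ⊆ Ω`
compact. Then `supCkENorm K k (bilinPullback (pointPush χ v) G − G) → 0` as `v → 0`: the components
of a smooth covariant `2`-tensor pulled back along `y ↦ y + χ(y) • v` converge, with `k` derivatives
uniformly on `K`, to the components themselves (Petersen 2006, Ch. 10, §3.2: smooth convergence of
metrics along diffeomorphisms converging smoothly to the identity). [cite: Petersen2006, Ch. 10 §3.2] -/
theorem tendsto_supCkENorm_bilinPullback_pointPush_sub [ProperSpace E] {χ : E → ℝ}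
    (hχ : ContDiff ℝ ∞ χ)
    {G : E → E →L[ℝ] E →L[ℝ] ℝ} {Ω : Set E} (hΩ : IsOpen Ω) (hG : ContDiffOn ℝ ∞ G Ω)
    {K : Set E} (hK : IsCompact K) (hKΩ : K ⊆ Ω) (k : ℕ) :
    Tendsto (fun v : E ↦ supCkENorm K k (bilinPullback (pointPush χ v) G - G)) (𝓝 0) (𝓝 0) := by
  have hχd : Differentiable ℝ χ := hχ.differentiable (by simp)
  -- the open set of joint smoothness and a product neighbourhood of `K × {0}` inside it
  set S : Set (E × E) := {p : E × E | p.1 ∈ Ω ∧ p.1 + χ p.1 • p.2 ∈ Ω} with hS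
  have hSo : IsOpen S := by
    have hc : Continuous fun p : E × E ↦ p.1 + χ p.1 • p.2 :=
      continuous_fst.add ((hχ.continuous.comp continuous_fst).smul continuous_snd)
    exact (hΩ.preimage continuous_fst).inter (hΩ.preimage hc)
  have hK0 : K ×ˢ ({0} : Set E) ⊆ S := by
    rintro ⟨y, v⟩ ⟨hy, hv⟩
    rw [mem_singleton_iff] at hv
    subst hv
    exact ⟨hKΩ hy, by simpa using hKΩ hy⟩
  obtain ⟨U, V, hU, hV, hKU, h0V, hUV⟩ := generalized_tube_lemma hK isCompact_singleton hSo hK0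
  obtain ⟨δ, hδ, hδV⟩ := Metric.nhds_basis_closedBall.mem_iff.1 (hV.mem_nhds (h0V rfl))
  -- the joint function and its derivatives, continuous on the compact `K × closedBall 0 δ`
  set H := pushPullbackDiff χ G with hH
  have hHs : ContDiffOn ℝ ∞ H S := contDiffOn_pushPullbackDiff hχ hG
  have hKδ : K ×ˢ closedBall (0 : E) δ ⊆ S := fun p hp ↦ hUV ⟨hKU hp.1, hδV hp.2⟩
  have hKδc : IsCompact (K ×ˢ closedBall (0 : E) δ) := hK.prod (isCompact_closedBall _ _)
  -- pointwise identities
  have hslice : ∀ v : E, (fun y ↦ H (y, v)) = bilinPullback (pointPush χ v) G - G := fun v ↦ by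
    funext y; simp only [hH, pushPullbackDiff_apply hχd, Pi.sub_apply]
  have hpartial : ∀ {y v : E}, (y, v) ∈ S → ∀ j : ℕ,
      iteratedFDeriv ℝ j (bilinPullback (pointPush χ v) G - G) y =
        (iteratedFDeriv ℝ j H (y, v)).compContinuousLinearMap
          fun _ ↦ ContinuousLinearMap.inl ℝ E E := by
    intro y v hyv j
    rw [← hslice v]
    exact iteratedFDeriv_curry_left_eq_compContinuousLinearMap_inl hSo hHs hyv j
  have hzero : ∀ {y : E}, (y, (0 : E)) ∈ S → ∀ j : ℕ,
      (iteratedFDeriv ℝ j H (y, 0)).compContinuousLinearMap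
        (fun _ ↦ ContinuousLinearMap.inl ℝ E E) = 0 := by
    intro y hy j
    rw [← hpartial hy j, pointPush_zero, bilinPullback_id]
    have h0 : (G - G : E → E →L[ℝ] E →L[ℝ] ℝ) = 0 := sub_self G
    rw [h0]
    simp
  -- the `ε`-argument
  rw [ENNReal.tendsto_nhds_zero]
  intro ε hε
  -- a real `ε'` below `ε`
  obtain ⟨ε', hε', hε'ε⟩ : ∃ ε' : ℝ, 0 < ε' ∧ ENNReal.ofReal ε' ≤ ε := by
    rcases eq_or_ne ε ⊤ with h | h
    · exact ⟨1, one_pos, h ▸ le_top⟩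
    · exact ⟨ε.toReal, ENNReal.toReal_pos hε.ne' h, ENNReal.ofReal_toReal_le⟩
  -- uniform continuity of each derivative of order `≤ k` on the compact set
  have hstep : ∀ j : ℕ, ∃ η : ℝ, 0 < η ∧ ∀ y ∈ K, ∀ v : E, ‖v‖ < η → ‖v‖ ≤ δ →
      ‖iteratedFDeriv ℝ j H (y, v) - iteratedFDeriv ℝ j H (y, 0)‖ < ε' := by
    intro j
    have hcont : ContinuousOn (iteratedFDeriv ℝ j H) (K ×ˢ closedBall (0 : E) δ) := by
      have h1 : ContinuousOn (iteratedFDerivWithin ℝ j H S) S :=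
        hHs.continuousOn_iteratedFDerivWithin (by exact_mod_cast le_top) hSo.uniqueDiffOn
      exact (h1.congr fun p hp ↦ (iteratedFDerivWithin_of_isOpen j hSo hp).symm).mono hKδ
    have huc := hKδc.uniformContinuousOn_of_continuous hcont
    obtain ⟨η, hη, hηuc⟩ := Metric.uniformContinuousOn_iff.1 huc ε' hε'
    refine ⟨η, hη, fun y hy v hv hvδ ↦ ?_⟩
    have hy0 : (y, (0 : E)) ∈ K ×ˢ closedBall (0 : E) δ := ⟨hy, mem_closedBall_self hδ.le⟩
    have hyv : (y, v) ∈ K ×ˢ closedBall (0 : E) δ := ⟨hy, by simpa using hvδ⟩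
    have hdist : dist (y, v) (y, (0 : E)) < η := by
      rw [Prod.dist_eq, dist_self, dist_zero_right, max_eq_right (norm_nonneg _)]
      exact hv
    have := hηuc (y, v) hyv (y, 0) hy0 hdist
    rwa [dist_eq_norm] at this
  choose η hη hηε using hstep
  -- a common threshold
  set η₀ : ℝ := min δ (Finset.inf' (Finset.range (k + 1)) (by simp) η) with hη₀
  have hη₀pos : 0 < η₀ := lt_min hδ (by
    rw [Finset.lt_inf'_iff]; intro j _; exact hη j)
  have hball : ball (0 : E) η₀ ∈ 𝓝 (0 : E) := ball_mem_nhds _ hη₀pos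
  filter_upwards [hball] with v hv
  rw [mem_ball, dist_zero_right] at hv
  have hvδ : ‖v‖ ≤ δ := (hv.trans_le (min_le_left _ _)).le
  have hvη : ∀ j, j ≤ k → ‖v‖ < η j := fun j hj ↦
    hv.trans_le ((min_le_right _ _).trans (Finset.inf'_le _ (Finset.mem_range.2 (Nat.lt_succ_of_le hj))))
  refine (supCkENorm_le_ofReal fun j hj y hy ↦ ?_).trans hε'ε
  have hyvS : (y, v) ∈ S := hKδ ⟨hy, by simpa using hvδ⟩
  have hy0S : (y, (0 : E)) ∈ S := hKδ ⟨hy, mem_closedBall_self hδ.le⟩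
  -- bound the restricted derivative through its values (no linear algebra on the map spaces)
  rw [hpartial hyvS j]
  set A := iteratedFDeriv ℝ j H (y, v) with hA
  set A₀ := iteratedFDeriv ℝ j H (y, 0) with hA₀
  have hAA₀ : ‖A - A₀‖ < ε' := hηε j y hy v (hvη j hj) hvδ
  refine ContinuousMultilinearMap.opNorm_le_bound (hε'.le) fun m ↦ ?_
  rw [ContinuousMultilinearMap.compContinuousLinearMap_apply]
  have h0 : A₀ (fun i ↦ ContinuousLinearMap.inl ℝ E E (m i)) = 0 := by
    have h := congrArg (fun N : ContinuousMultilinearMap ℝ (fun _ : Fin j ↦ E) (E →L[ℝ] E →L[ℝ] ℝ) ↦ N m)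
      (hzero hy0S j)
    simpa only [ContinuousMultilinearMap.compContinuousLinearMap_apply, zero_apply] using h
  have h1 : A (fun i ↦ ContinuousLinearMap.inl ℝ E E (m i)) =
      (A - A₀) (fun i ↦ ContinuousLinearMap.inl ℝ E E (m i)) := by
    rw [sub_apply, h0]
    exact (sub_zero (A fun i ↦ ContinuousLinearMap.inl ℝ E E (m i) : E →L[ℝ] E →L[ℝ] ℝ)).symm
  rw [h1]
  refine ((A - A₀).le_opNorm _).trans ?_
  have hprod : ∏ i : Fin j, ‖ContinuousLinearMap.inl ℝ E E (m i)‖ = ∏ i : Fin j, ‖m i‖ := by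
    refine Finset.prod_congr rfl fun i _ ↦ ?_
    rw [ContinuousLinearMap.inl_apply, Prod.norm_def, norm_zero, max_eq_left (norm_nonneg _)]
  rw [hprod]
  exact mul_le_mul_of_nonneg_right hAA₀.le (Finset.prod_nonneg fun i _ ↦ norm_nonneg _)

end PointPushPullback

end Literature.Geometry.Lorentzian
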